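import Mathlib
import HarnessLib
import Literature.MathematicalPhysics.StatisticalMechanics.InitialActivityPerturbationLipschitz
import Literature.MathematicalPhysics.StatisticalMechanics.PolymerProductSecondDifference

/-!
# [ABKM19] Lemma 12.3 at second order, difference form: mixed second differences of the initial
# polymer activity `K_0(X) = ∏_{x∈X} 𝒦(∇φ(x))` in the perturbation `𝒦`

Continuation of `InitialActivityPerturbationLipschitz.lean` (first differences in `𝒦`).  The map
`𝒦 ↦ ∏_{x∈X}𝒦(∇φ(x))` is multi-affine, so over a parallelogram `𝒦, 𝒦+U, 𝒦+V, 𝒦+U+V` of `C^{r₀}` complex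
perturbations with `‖D^s𝒦(z)‖ ≤ ρe^{|z|²/4}`, `‖D^sU(z)‖ ≤ ue^{|z|²/4}`, `‖D^sV(z)‖ ≤ ve^{|z|²/4}` (`s ≤ r₀`)
its mixed second difference is controlled by `PolymerProductSecondDifference.tayNormLE_prod_secondDiff`
with the single-site entry estimate of Lemma 12.3:

* **`tayNormLE_initK_secondDiff`** —
  `|∏(𝒦+U+V) − ∏(𝒦+U) − ∏(𝒦+V) + ∏𝒦|_{T_φ} ≤ Δ²_{u,v}[(t e^{𝔥/R})^{|X|}](ρ) · e^{¼Σ_{x∈X}|∇φ(x)|²}`, where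
  `Δ²_{u,v}[F](ρ) = F(ρ+u+v) − F(ρ+u) − F(ρ+v) + F(ρ)` is the numerical second difference
  (`≤ |X|(|X|−1)uv((ρ+u+v)e^{𝔥/R})^{|X|−2}e^{2𝔥/R}`).

This is the `𝒦𝒦`-slot of the joint second differences of `K̂_0(𝒦, ℋ) = e^{−ℋ}∏𝒦` required by the
second-order fixed-point theorem `RGFlow.secondDiff_initial_le_of_isTunedQ` (hypothesis `hμ12`).
Everything is proved; no named fact.

## References
* S. Adams, S. Buchholz, R. Kotecký, S. Müller, arXiv:1910.13564, Lemma 12.3 (12.17)–(12.18),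
  Lemma 12.2 (12.9) with `j₁ = 2` [AdamsBuchholzKoteckyMuller2019].
-/

noncomputable section

namespace Literature.MathematicalPhysics.StatisticalMechanics.GradientRG

open scoped BigOperators Classical
open Finset Matrix
open Literature.MathematicalPhysics.QuantumFieldTheory

variable {d M : ℕ} [NeZero M]

/-- **Mixed second differences of the site product in the perturbation** ([ABKM19] Lemma 12.3,
second order, difference form). [cite: AdamsBuchholzKoteckyMuller2019, Lemma 12.3 (12.18)] -/
theorem tayNormLE_initK_secondDiff {r₀ : ℕ} {ρ u v : ℝ} {𝒦 U W : (Fin d → ℝ) → ℂ}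
    (h𝒦 : ContDiff ℝ r₀ 𝒦) (hU : ContDiff ℝ r₀ U) (hW : ContDiff ℝ r₀ W)
    (h𝒦b : ∀ k, k ≤ r₀ → ∀ z : Fin d → ℝ, ‖iteratedFDeriv ℝ k 𝒦 z‖ ≤ ρ * Real.exp ((∑ i, z i ^ 2) / 4))
    (hUb : ∀ k, k ≤ r₀ → ∀ z : Fin d → ℝ, ‖iteratedFDeriv ℝ k U z‖ ≤ u * Real.exp ((∑ i, z i ^ 2) / 4))
    (hWb : ∀ k, k ≤ r₀ → ∀ z : Fin d → ℝ, ‖iteratedFDeriv ℝ k W z‖ ≤ v * Real.exp ((∑ i, z i ^ 2) / 4))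
    {𝔥 R : ℝ} (h𝔥 : 0 < 𝔥) (hR : 0 < R) {p : ℕ} (hp : 1 ≤ p) {S X : Finset (Fin d → ZMod M)}
    (hXS : X ⊆ S) :
    TayNormLE (fieldGauge 𝔥 R p S) r₀ (fun φ => Real.exp ((∑ x ∈ X, ∑ i, (gradAt x φ i) ^ 2) / 4))
      (fun φ => initK (fun z => 𝒦 z + U z + W z) X φ - initK (fun z => 𝒦 z + U z) X φ
        - initK (fun z => 𝒦 z + W z) X φ + initK 𝒦 X φ)
      ((((ρ + u + v) * Real.exp (𝔥 / R)) ^ X.card - ((ρ + u) * Real.exp (𝔥 / R)) ^ X.card)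
        - (((ρ + v) * Real.exp (𝔥 / R)) ^ X.card - (ρ * Real.exp (𝔥 / R)) ^ X.card)) := by
  have nonneg_of : ∀ {F : (Fin d → ℝ) → ℂ} {t : ℝ},
      (∀ k, k ≤ r₀ → ∀ z : Fin d → ℝ, ‖iteratedFDeriv ℝ k F z‖ ≤ t * Real.exp ((∑ i, z i ^ 2) / 4)) → 0 ≤ t :=
    fun hb => by
      have h0 := (norm_nonneg _).trans (hb 0 (Nat.zero_le _) 0)
      exact (mul_nonneg_iff_of_pos_right (Real.exp_pos _)).1 h0
  have hρ : 0 ≤ ρ := nonneg_of h𝒦b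
  have hu : 0 ≤ u := nonneg_of hUb
  have hv : 0 ≤ v := nonneg_of hWb
  set e' := Real.exp (𝔥 / R) with he'
  have he'0 : 0 ≤ e' := (Real.exp_pos _).le
  -- per-site data (Lemma 12.3 on singletons)
  have single : ∀ {F : (Fin d → ℝ) → ℂ} {t : ℝ}, ContDiff ℝ r₀ F →
      (∀ k, k ≤ r₀ → ∀ z : Fin d → ℝ, ‖iteratedFDeriv ℝ k F z‖ ≤ t * Real.exp ((∑ i, z i ^ 2) / 4)) →
      ∀ x ∈ X, TayNormLE (fieldGauge 𝔥 R p S) r₀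
        (fun φ => Real.exp ((∑ y ∈ ({x} : Finset (Fin d → ZMod M)), ∑ i, (gradAt y φ i) ^ 2) / 4))
        (initK F {x}) (t * e') := by
    intro F t hF hFb x hx φ
    have h := tayNorm_initK_le (M := M) hF hFb h𝔥 hR hp (Finset.singleton_subset_iff.2 (hXS hx)) φ
    rw [Finset.card_singleton, pow_one] at h
    exact h
  have hloc : ∀ (F : (Fin d → ℝ) → ℂ), ∀ x ∈ X, IsGaugeLocal (fieldGauge 𝔥 R p S) (initK (M := M) F {x}) :=
    fun F x hx => isGaugeLocal_initK F h𝔥 hR hp (Finset.singleton_subset_iff.2 (hXS hx))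
  have hmain := tayNormLE_prod_secondDiff (T := fieldGauge 𝔥 R p S) (Ti := fun _ => fieldGauge 𝔥 R p S)
    (wi := fun x φ => Real.exp ((∑ y ∈ ({x} : Finset (Fin d → ZMod M)), ∑ i, (gradAt y φ i) ^ 2) / 4))
    (Ki := fun x => initK 𝒦 {x}) (Ui := fun x => initK U {x}) (Wi := fun x => initK W {x})
    (c := fun _ => ρ * e') (u := fun _ => u * e') (v := fun _ => v * e')
    (w := fun φ => Real.exp ((∑ x ∈ X, ∑ i, (gradAt x φ i) ^ 2) / 4)) X
    (single h𝒦 h𝒦b) (single hU hUb) (single hW hWb) (fun _ _ _ => le_rfl)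
    (fun x _ => contDiff_initK h𝒦 {x}) (fun x _ => contDiff_initK hU {x}) (fun x _ => contDiff_initK hW {x})
    (hloc 𝒦) (hloc U) (hloc W)
    (fun _ _ => mul_nonneg hρ he'0) (fun _ _ => mul_nonneg hu he'0) (fun _ _ => mul_nonneg hv he'0)
    (fun φ => by
      rw [← Real.exp_sum, ← Finset.sum_div]
      simp only [Finset.sum_singleton]
      exact le_rfl)
  have hfun : (fun φ => ∏ x ∈ X, (initK 𝒦 {x} φ + initK U {x} φ + initK W {x} φ)
        - ∏ x ∈ X, (initK 𝒦 {x} φ + initK U {x} φ) - ∏ x ∈ X, (initK 𝒦 {x} φ + initK W {x} φ)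
        + ∏ x ∈ X, initK 𝒦 {x} φ)
      = fun φ => initK (M := M) (fun z => 𝒦 z + U z + W z) X φ - initK (fun z => 𝒦 z + U z) X φ
        - initK (fun z => 𝒦 z + W z) X φ + initK 𝒦 X φ := by
    funext φ
    simp [initK, Finset.prod_singleton]
  have hconst : ((∏ _x ∈ X, (ρ * e' + u * e' + v * e')) - ∏ _x ∈ X, (ρ * e' + u * e'))
        - ((∏ _x ∈ X, (ρ * e' + v * e')) - ∏ _x ∈ X, ρ * e')
      = (((ρ + u + v) * e') ^ X.card - ((ρ + u) * e') ^ X.card)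
        - (((ρ + v) * e') ^ X.card - (ρ * e') ^ X.card) := by
    simp only [Finset.prod_const, ← add_mul]
  rw [hfun, hconst] at hmain
  exact hmain

end Literature.MathematicalPhysics.StatisticalMechanics.GradientRG

end
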